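import Literature.NumberTheory.EllipticCurves.WeierstrassPDivisionValuesRows
import Mathlib.NumberTheory.ModularForms.QExpansion
import Mathlib.Analysis.Complex.LocallyUniformLimit
import Mathlib.Analysis.Normed.Ring.InfiniteSum
import Mathlib.Analysis.Normed.Group.Tannery
import HarnessLib

/-!
# `℘`-division values at `i∞`: the `q_N`-expansion, limits, boundedness and holomorphy

Topic `Literature/NumberTheory/EllipticCurves`; namespace
`Literature.NumberTheory.EllipticCurves.ModularForms`.

Summing the rows (`WeierstrassPDivisionValuesRows`) of the lattice sum of the `℘`-division value
`f_v(τ) = ℘_{Λ_τ}((c_v τ + d_v)/N)` gives an ABSOLUTELY convergent expansion in monomials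
`q_N^j = e^{2πijτ/N}` (`hasSum_weierstrassPDiv_monomials`): with `c_m = c_v - Nm`,

  `f_v(τ) = K_v + ∑_{m, r ≥ 0 : c_m ≠ 0} (-2πi)² r ζ_N^{sgn(c_m) r d_v} q_N^{r|c_m|}
              - ∑_{m ≠ 0, r ≥ 0} (-2πi)² r q_N^{rN|m|}`,

`K_v = [N ∣ c_v] N² ∑_n (d_v - Nn)^{-2} - 2ζ(2)`, whose coefficients are dominated by the summable
product `x^{|c_m| - 1} · r x^r` (`x = |q_N|`).  Consequences (Diamond–Shurman §4.6, the Fourier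
expansion of `℘` at division points, and §1.5):

* `tendsto_weierstrassPDiv_atImInfty` — `f_v(τ) → K_v` as `Im τ → ∞`, in particular
  `→ -2ζ(2) = -π²/3` when `N ∤ c_v` (Tannery's theorem);
* `isBoundedAtImInfty_weierstrassPDiv` — every `f_v` is bounded at `i∞` (hence, by the
  transformation law `f_v ∣₂ γ = f_{vγ}`, at every cusp);
* `mdifferentiable_weierstrassPDiv` — `f_v` is holomorphic on `ℍ` (locally uniform convergence of
  the monomial expansion).

## References

* F. Diamond, J. Shurman, *A First Course in Modular Forms*, GTM 228 (2005), §1.5, §4.6.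
  [DiamondShurman2005]
-/

noncomputable section

open UpperHalfPlane EisensteinSeries Complex Filter Function

open scoped Real MatrixGroups Topology Manifold

namespace Literature.NumberTheory.EllipticCurves.ModularForms

/-! ### The monomial expansion: coefficients and exponents -/

/-- The constant term `K_v = [N ∣ c_v] N² ∑_{n ∈ ℤ} (d_v - Nn)^{-2} - 2ζ(2)` of the
`q_N`-expansion of `f_v`. [cite: DiamondShurman2005, §4.6] -/
def weierstrassPDivConst (N : ℕ) (v : Fin 2 → ℤ) : ℂ :=
  (if (N : ℤ) ∣ v 0 then (N : ℂ) ^ 2 * ∑' n : ℤ, (((v 1 - N * n : ℤ) : ℂ) ^ 2)⁻¹ else 0) -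
    2 * riemannZeta 2

/-- The coefficients of the monomial expansion of `f_v`, indexed by
`Unit ⊕ (ℤ × ℕ) ⊕ (ℤ × ℕ)` (constant term; the pieces `A_m`, `m ∈ ℤ`, `r ≥ 0`; the pieces
`B_m`, `m ∈ ℤ`, `r ≥ 0`). [cite: DiamondShurman2005, §4.6] -/
def weierstrassPDivCoeff (N : ℕ) (v : Fin 2 → ℤ) : Unit ⊕ (ℤ × ℕ) ⊕ (ℤ × ℕ) → ℂ
  | Sum.inl _ => weierstrassPDivConst N v
  | Sum.inr (Sum.inl p) =>
      if v 0 - N * p.1 = 0 then 0 else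
        (-2 * π * Complex.I) ^ 2 * p.2 *
          cexp (2 * π * Complex.I * (((v 0 - N * p.1).sign * p.2 * v 1 : ℤ) : ℂ) / N)
  | Sum.inr (Sum.inr p) => if p.1 = 0 then 0 else -((-2 * π * Complex.I) ^ 2 * p.2)

/-- The exponents (of `q_N = e^{2πiτ/N}`) of the monomial expansion of `f_v`. [cite: DiamondShurman2005, §4.6] -/
def weierstrassPDivExp (N : ℕ) (v : Fin 2 → ℤ) : Unit ⊕ (ℤ × ℕ) ⊕ (ℤ × ℕ) → ℕ
  | Sum.inl _ => 0
  | Sum.inr (Sum.inl p) => p.2 * (v 0 - N * p.1).natAbs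
  | Sum.inr (Sum.inr p) => p.2 * (N * p.1.natAbs)

variable {N : ℕ} [NeZero N]

/-! ### Summability of the dominating product -/

/-- `n ↦ x^{n-1}` is summable on `ℕ` for `0 ≤ x < 1`. [folklore] -/
theorem summable_pow_sub_one {x : ℝ} (hx : 0 ≤ x) (hx1 : x < 1) :
    Summable fun n : ℕ ↦ x ^ (n - 1) := by
  rw [← summable_nat_add_iff 1]
  simpa using summable_geometric_of_lt_one hx hx1

omit [NeZero N] in
/-- `m ↦ x^{|c - Nm| - 1}` is summable on `ℤ` (`N ≠ 0`, `0 ≤ x < 1`). [folklore] -/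
theorem summable_pow_natAbs_sub (hN : N ≠ 0) (c : ℤ) {x : ℝ} (hx : 0 ≤ x) (hx1 : x < 1) :
    Summable fun m : ℤ ↦ x ^ ((c - N * m).natAbs - 1) := by
  have hZ : Summable fun k : ℤ ↦ x ^ (k.natAbs - 1) := by
    refine summable_int_iff_summable_nat_and_neg.2 ⟨?_, ?_⟩
    · simpa using summable_pow_sub_one hx hx1
    · simpa using summable_pow_sub_one hx hx1
  have hinj : Function.Injective fun m : ℤ ↦ c - N * m := fun a b hab ↦ by
    simpa [hN] using hab
  exact hZ.comp_injective hinj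

/-- `r ↦ r x^r` is summable for `0 ≤ x < 1`. [folklore] -/
theorem summable_natCast_mul_pow {x : ℝ} (hx : 0 ≤ x) (hx1 : x < 1) :
    Summable fun r : ℕ ↦ (r : ℝ) * x ^ r := by
  simpa using summable_pow_mul_geometric_of_norm_lt_one 1 (by rwa [Real.norm_of_nonneg hx])

/-- The elementary exponent inequality `r e ≥ e - 1 + r` for `r, e ≥ 1`, giving
`x^{re} ≤ x^{e-1} x^r`. [folklore] -/
theorem pow_mul_le_pow_sub_one_mul_pow {x : ℝ} (hx : 0 ≤ x) (hx1 : x ≤ 1) {r e : ℕ} (hr : 1 ≤ r)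
    (he : 1 ≤ e) : x ^ (r * e) ≤ x ^ (e - 1) * x ^ r := by
  rw [← pow_add]
  refine pow_le_pow_of_le_one hx hx1 ?_
  have : (r - 1) * (e - 1) + (e - 1 + r) = r * e := by
    obtain ⟨r', rfl⟩ : ∃ r', r = r' + 1 := ⟨r - 1, by omega⟩
    obtain ⟨e', rfl⟩ : ∃ e', e = e' + 1 := ⟨e - 1, by omega⟩
    simp only [Nat.add_sub_cancel]
    ring
  omega

/-- **The coefficients of the monomial expansion are absolutely summable against `x^{exponent}`
for every `0 ≤ x < 1`** (domination by the summable product `4π² x^{|c_m|-1} · r x^r`, resp.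
`4π² x^{N|m|-1} · r x^r`, plus the constant). [cite: DiamondShurman2005, §4.6] -/
theorem summable_norm_weierstrassPDivCoeff_mul_pow (v : Fin 2 → ℤ) {x : ℝ} (hx : 0 ≤ x)
    (hx1 : x < 1) :
    Summable fun i ↦ ‖weierstrassPDivCoeff N v i‖ * x ^ weierstrassPDivExp N v i := by
  have hN : N ≠ 0 := NeZero.ne N
  have h4 : ‖(-2 * π * Complex.I) ^ 2‖ = 4 * π ^ 2 := by
    rw [norm_pow, norm_mul, norm_mul, norm_neg, Complex.norm_ofNat, Complex.norm_real,
      Complex.norm_I, mul_one, Real.norm_of_nonneg Real.pi_pos.le]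
    ring
  refine Summable.sum _ ?_ (Summable.sum _ ?_ ?_)
  · exact (hasSum_fintype _).summable
  · -- the `A`-pieces
    have hdom : Summable fun p : ℤ × ℕ ↦
        x ^ ((v 0 - N * p.1).natAbs - 1) * ((p.2 : ℝ) * x ^ p.2) :=
      (summable_pow_natAbs_sub hN (v 0) hx hx1).mul_of_nonneg (summable_natCast_mul_pow hx hx1)
        (fun m ↦ pow_nonneg hx _) (fun r ↦ mul_nonneg r.cast_nonneg (pow_nonneg hx _))
    refine Summable.of_nonneg_of_le (fun p ↦ mul_nonneg (norm_nonneg _) (pow_nonneg hx _))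
      (fun p ↦ ?_) (hdom.mul_left (4 * π ^ 2))
    rcases p with ⟨m, r⟩
    simp only [Function.comp_apply, weierstrassPDivCoeff, weierstrassPDivExp]
    split_ifs with hc
    · simp only [norm_zero, zero_mul]
      positivity
    · rw [norm_mul, norm_mul, h4, Complex.norm_natCast, Complex.norm_exp]
      have hre : (2 * π * Complex.I * (((v 0 - N * m).sign * r * v 1 : ℤ) : ℂ) / N).re = 0 := by
        rw [Complex.div_natCast_re]
        simp
      rw [hre, Real.exp_zero, mul_one]
      rcases Nat.eq_zero_or_pos r with rfl | hr
      · simp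
      · have he : 1 ≤ (v 0 - N * m).natAbs := Int.natAbs_pos.mpr hc
        calc 4 * π ^ 2 * (r : ℝ) * x ^ (r * (v 0 - ↑N * m).natAbs)
            ≤ 4 * π ^ 2 * (r : ℝ) * (x ^ ((v 0 - ↑N * m).natAbs - 1) * x ^ r) := by
              gcongr
              exact pow_mul_le_pow_sub_one_mul_pow hx hx1.le hr he
          _ = 4 * π ^ 2 * (x ^ ((v 0 - ↑N * m).natAbs - 1) * ((r : ℝ) * x ^ r)) := by ring
  · -- the `B`-pieces
    have hdom : Summable fun p : ℤ × ℕ ↦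
        x ^ ((0 - N * p.1).natAbs - 1) * ((p.2 : ℝ) * x ^ p.2) :=
      (summable_pow_natAbs_sub hN 0 hx hx1).mul_of_nonneg (summable_natCast_mul_pow hx hx1)
        (fun m ↦ pow_nonneg hx _) (fun r ↦ mul_nonneg r.cast_nonneg (pow_nonneg hx _))
    refine Summable.of_nonneg_of_le (fun p ↦ mul_nonneg (norm_nonneg _) (pow_nonneg hx _))
      (fun p ↦ ?_) (hdom.mul_left (4 * π ^ 2))
    rcases p with ⟨m, r⟩
    simp only [Function.comp_apply, weierstrassPDivCoeff, weierstrassPDivExp]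
    split_ifs with hm
    · simp only [norm_zero, zero_mul]
      positivity
    · rw [norm_neg, norm_mul, h4, Complex.norm_natCast]
      have hnat : (0 - (N : ℤ) * m).natAbs = N * m.natAbs := by
        rw [zero_sub, Int.natAbs_neg, Int.natAbs_mul, Int.natAbs_natCast]
      rw [hnat]
      rcases Nat.eq_zero_or_pos r with rfl | hr
      · simp
      · have he : 1 ≤ N * m.natAbs := Nat.one_le_iff_ne_zero.mpr
          (Nat.mul_ne_zero hN (Int.natAbs_ne_zero.mpr hm))
        calc 4 * π ^ 2 * (r : ℝ) * x ^ (r * (N * m.natAbs))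
            ≤ 4 * π ^ 2 * (r : ℝ) * (x ^ (N * m.natAbs - 1) * x ^ r) := by
              gcongr
              exact pow_mul_le_pow_sub_one_mul_pow hx hx1.le hr he
          _ = 4 * π ^ 2 * (x ^ (N * m.natAbs - 1) * ((r : ℝ) * x ^ r)) := by ring

/-! ### The monomial expansion sums to `f_v` -/

omit [NeZero N] in
/-- `e^{2πi (cτ + d)/N} = e^{2πi d/N} q_N^c` for `c ∈ ℕ`. [folklore] -/
theorem cexp_two_pi_I_linear_div (c : ℕ) (d : ℤ) (τ : ℍ) :
    cexp (2 * π * Complex.I * (((c : ℂ) * τ + d) / N)) =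
      cexp (2 * π * Complex.I * d / N) * Periodic.qParam N τ ^ c := by
  simp only [Periodic.qParam]
  rw [← Complex.exp_nat_mul, ← Complex.exp_add]
  congr 1
  push_cast
  ring

omit [NeZero N] in
/-- Powers: `(e^{2πi (cτ + d)/N})^r = e^{2πi rd/N} q_N^{rc}`. [folklore] -/
theorem cexp_two_pi_I_linear_div_pow (c : ℕ) (d : ℤ) (τ : ℍ) (r : ℕ) :
    cexp (2 * π * Complex.I * (((c : ℂ) * τ + d) / N)) ^ r =
      cexp (2 * π * Complex.I * ((r * d : ℤ) : ℂ) / N) * Periodic.qParam N τ ^ (r * c) := by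
  rw [cexp_two_pi_I_linear_div, mul_pow, ← Complex.exp_nat_mul, pow_mul']
  congr 2
  push_cast
  ring

omit [NeZero N] in
/-- `‖e^{2πi (cτ + d)/N}‖ < 1` for `c ≥ 1`. [folklore] -/
theorem norm_cexp_two_pi_I_linear_div_lt_one (hN : 0 < N) {c : ℕ} (hc : 1 ≤ c) (d : ℤ) (τ : ℍ) :
    ‖cexp (2 * π * Complex.I * (((c : ℂ) * τ + d) / N))‖ < 1 := by
  rw [cexp_two_pi_I_linear_div, norm_mul, Complex.norm_exp]
  have hre : (2 * π * Complex.I * (d : ℂ) / N).re = 0 := by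
    rw [Complex.div_natCast_re]
    simp
  rw [hre, Real.exp_zero, one_mul, norm_pow]
  have hq : ‖Periodic.qParam N τ‖ < 1 := Periodic.norm_qParam_lt_one (Nat.cast_pos.mpr hN) τ.im_pos
  exact pow_lt_one₀ (norm_nonneg _) hq (by omega)

/-- **The `A`-pieces**: for fixed `m`, the monomials `(m, r)`, `r ≥ 0`, sum to
`[c_m ≠ 0] N² A_m(τ)`. [cite: DiamondShurman2005, §4.6] -/
theorem hasSum_weierstrassPDivCoeff_A (v : Fin 2 → ℤ) (τ : ℍ) (m : ℤ) :
    HasSum (fun r : ℕ ↦ weierstrassPDivCoeff N v (Sum.inr (Sum.inl (m, r))) *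
        Periodic.qParam N τ ^ weierstrassPDivExp N v (Sum.inr (Sum.inl (m, r))))
      (if v 0 - N * m = 0 then 0 else
        (N : ℂ) ^ 2 * ∑' n : ℤ, eisSummand 2 ![v 0 - N * m, v 1 - N * n] τ) := by
  have hN0 : (N : ℂ) ≠ 0 := by exact_mod_cast NeZero.ne N
  rcases lt_trichotomy (v 0 - N * m) 0 with hc | hc | hc
  · -- `c < 0`
    rw [if_neg hc.ne, tsum_eisSummand_two_residue_of_neg hc, ← mul_assoc, ← mul_assoc,
      mul_inv_cancel₀ (pow_ne_zero 2 hN0), one_mul]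
    obtain ⟨e, he⟩ : ∃ e : ℕ, ((-(v 0 - N * m) : ℤ)) = e := ⟨(v 0 - N * m).natAbs, by omega⟩
    have he1 : 1 ≤ e := by omega
    have hE := norm_cexp_two_pi_I_linear_div_lt_one (NeZero.pos N) he1 (-(v 1)) τ
    have hs : HasSum (fun r : ℕ ↦ (-2 * π * Complex.I) ^ 2 *
        ((r : ℂ) * cexp (2 * π * Complex.I * (((e : ℂ) * τ + ((-(v 1) : ℤ) : ℂ)) / N)) ^ r))
        ((-2 * π * Complex.I) ^ 2 * ∑' r : ℕ,
          (r : ℂ) * cexp (2 * π * Complex.I * (((e : ℂ) * τ + ((-(v 1) : ℤ) : ℂ)) / N)) ^ r) := by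
      refine (Summable.hasSum ?_).mul_left _
      have h := summable_pow_mul_geometric_of_norm_lt_one 1 hE
      simp only [pow_one] at h
      exact h
    have hcast : (((-(v 0 - N * m) : ℤ)) : ℂ) = (e : ℂ) := by exact_mod_cast he
    rw [hcast]
    refine hs.congr_fun fun r ↦ ?_
    have habs : (v 0 - N * m).natAbs = e := by omega
    have hsign : (v 0 - N * m).sign = -1 := Int.sign_eq_neg_one_of_neg hc
    simp only [weierstrassPDivCoeff, weierstrassPDivExp, if_neg hc.ne, habs, hsign]
    rw [cexp_two_pi_I_linear_div_pow]
    push_cast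
    ring_nf
  · -- `c = 0`
    rw [if_pos hc]
    refine (hasSum_zero).congr_fun fun r ↦ ?_
    simp [weierstrassPDivCoeff, hc]
  · -- `c > 0`
    rw [if_neg hc.ne', tsum_eisSummand_two_residue_of_pos hc, ← mul_assoc, ← mul_assoc,
      mul_inv_cancel₀ (pow_ne_zero 2 hN0), one_mul]
    obtain ⟨e, he⟩ : ∃ e : ℕ, (v 0 - N * m : ℤ) = e := ⟨(v 0 - N * m).natAbs, by omega⟩
    have he1 : 1 ≤ e := by omega
    have hE := norm_cexp_two_pi_I_linear_div_lt_one (NeZero.pos N) he1 (v 1) τ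
    have hs : HasSum (fun r : ℕ ↦ (-2 * π * Complex.I) ^ 2 *
        ((r : ℂ) * cexp (2 * π * Complex.I * (((e : ℂ) * τ + ((v 1 : ℤ) : ℂ)) / N)) ^ r))
        ((-2 * π * Complex.I) ^ 2 * ∑' r : ℕ,
          (r : ℂ) * cexp (2 * π * Complex.I * (((e : ℂ) * τ + ((v 1 : ℤ) : ℂ)) / N)) ^ r) := by
      refine (Summable.hasSum ?_).mul_left _
      have h := summable_pow_mul_geometric_of_norm_lt_one 1 hE
      simp only [pow_one] at h
      exact h
    have hcast : (((v 0 - N * m : ℤ)) : ℂ) = (e : ℂ) := by exact_mod_cast he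
    rw [hcast]
    refine hs.congr_fun fun r ↦ ?_
    have habs : (v 0 - N * m).natAbs = e := by omega
    have hsign : (v 0 - N * m).sign = 1 := Int.sign_eq_one_of_pos hc
    simp only [weierstrassPDivCoeff, weierstrassPDivExp, if_neg hc.ne', habs, hsign]
    rw [cexp_two_pi_I_linear_div_pow]
    push_cast
    ring_nf

omit [NeZero N] in
/-- `e^{2πimτ} = q_N^{Nm}` for `m ∈ ℕ`. [folklore] -/
theorem cexp_two_pi_I_natCast_mul (hN : N ≠ 0) (m : ℕ) (τ : ℍ) :
    cexp (2 * π * Complex.I * ((m : ℂ) * τ)) = Periodic.qParam N τ ^ (N * m) := by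
  simp only [Periodic.qParam]
  rw [← Complex.exp_nat_mul]
  congr 1
  have hN0 : (N : ℂ) ≠ 0 := by exact_mod_cast hN
  push_cast
  field_simp

/-- **The `B`-pieces**: for fixed `m`, the monomials `(m, r)`, `r ≥ 0`, sum to
`-[m ≠ 0] B_m(τ) = -[m ≠ 0] e2Summand m τ`. [cite: DiamondShurman2005, §1.1, §4.6] -/
theorem hasSum_weierstrassPDivCoeff_B (v : Fin 2 → ℤ) (τ : ℍ) (m : ℤ) :
    HasSum (fun r : ℕ ↦ weierstrassPDivCoeff N v (Sum.inr (Sum.inr (m, r))) *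
        Periodic.qParam N τ ^ weierstrassPDivExp N v (Sum.inr (Sum.inr (m, r))))
      (if m = 0 then 0 else -e2Summand m τ) := by
  by_cases hm : m = 0
  · rw [if_pos hm]
    refine (hasSum_zero).congr_fun fun r ↦ ?_
    have h0 : weierstrassPDivCoeff N v (Sum.inr (Sum.inr (m, r))) = 0 := by
      simp only [weierstrassPDivCoeff, if_pos hm]
    rw [h0, zero_mul]
  rw [if_neg hm]
  -- reduce to `m = ±k`, `k > 0`
  obtain ⟨k, hk, hmk⟩ : ∃ k : ℕ, 0 < k ∧ (m = k ∨ m = -k) :=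
    ⟨m.natAbs, Int.natAbs_pos.mpr hm, Int.natAbs_eq m⟩
  have hev : e2Summand m τ = e2Summand (k : ℤ) τ := by
    rcases hmk with h | h
    · rw [h]
    · rw [h]
      exact e2Summand_even τ _
  have hnat : m.natAbs = k := by omega
  have hkpos : (0 : ℤ) < (k : ℤ) := by exact_mod_cast hk
  have hQdef : cexp (2 * π * Complex.I * (((k : ℤ) : ℂ) * τ)) = Periodic.qParam N τ ^ (N * k) := by
    rw [Int.cast_natCast]
    exact cexp_two_pi_I_natCast_mul (NeZero.ne N) k τ
  have h1 := e2Summand_of_pos hkpos τ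
  rw [hQdef] at h1
  rw [hev, h1]
  generalize hQ : Periodic.qParam N τ ^ (N * k) = Q
  have hq : ‖Q‖ < 1 := by
    rw [← hQ, norm_pow]
    exact pow_lt_one₀ (norm_nonneg _)
      (Periodic.norm_qParam_lt_one (Nat.cast_pos.mpr (NeZero.pos N)) τ.im_pos)
      (Nat.mul_ne_zero (NeZero.ne N) hk.ne')
  have hsum : Summable fun r : ℕ ↦ (r : ℂ) * Q ^ r := by
    have h := summable_pow_mul_geometric_of_norm_lt_one 1 hq
    simp only [pow_one] at h
    exact h
  have hs : HasSum (fun r : ℕ ↦ -((-2 * π * Complex.I) ^ 2 * ((r : ℂ) * Q ^ r)))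
      (-((-2 * π * Complex.I) ^ 2 * ∑' r : ℕ, (r : ℂ) * Q ^ r)) :=
    (hsum.hasSum.mul_left _).neg
  refine hs.congr_fun fun r ↦ ?_
  have hexp : weierstrassPDivExp N v (Sum.inr (Sum.inr (m, r))) = r * (N * k) := by
    simp only [weierstrassPDivExp, hnat]
  have hcoef : weierstrassPDivCoeff N v (Sum.inr (Sum.inr (m, r))) =
      -((-2 * π * Complex.I) ^ 2 * r) := by
    simp only [weierstrassPDivCoeff, if_neg hm]
  rw [hexp, hcoef, mul_comm r, pow_mul, hQ]
  ring

/-- The rows `m ↦ [c_m ≠ 0] N² A_m(τ)` are summable. [folklore] -/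
theorem summable_weierstrassPDiv_A (v : Fin 2 → ℤ) (τ : ℍ) :
    Summable fun m : ℤ ↦ (if v 0 - N * m = 0 then 0 else
        (N : ℂ) ^ 2 * ∑' n : ℤ, eisSummand 2 ![v 0 - N * m, v 1 - N * n] τ) := by
  have hq0 : 0 ≤ ‖Periodic.qParam N τ‖ := norm_nonneg _
  have hq : ‖Periodic.qParam N τ‖ < 1 := Periodic.norm_qParam_lt_one (Nat.cast_pos.mpr (NeZero.pos N)) τ.im_pos
  have hS := ((summable_norm_weierstrassPDivCoeff_mul_pow (N := N) v hq0 hq).comp_injective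
    Sum.inr_injective).comp_injective Sum.inl_injective
  have hS' : Summable fun p : ℤ × ℕ ↦ weierstrassPDivCoeff N v (Sum.inr (Sum.inl p)) *
      Periodic.qParam N τ ^ weierstrassPDivExp N v (Sum.inr (Sum.inl p)) :=
    Summable.of_norm (hS.congr fun p ↦ by simp [norm_pow])
  refine hS'.prod.congr fun m ↦ ?_
  exact (hasSum_weierstrassPDivCoeff_A v τ m).tsum_eq

omit [NeZero N] in
/-- The rows `m ↦ -[m ≠ 0] B_m(τ) = -[m ≠ 0] e2Summand m τ` are summable (exponential decay of
`e2Summand m τ` in `|m|`). [folklore] -/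
theorem summable_ite_neg_e2Summand (τ : ℍ) :
    Summable fun m : ℤ ↦ (if m = 0 then 0 else -e2Summand m τ) := by
  have hq0 : 0 ≤ ‖Periodic.qParam (1 : ℕ) τ‖ := norm_nonneg _
  have hq : ‖Periodic.qParam (1 : ℕ) τ‖ < 1 :=
    Periodic.norm_qParam_lt_one (Nat.cast_pos.mpr Nat.one_pos) τ.im_pos
  have hS := ((summable_norm_weierstrassPDivCoeff_mul_pow (N := 1) 0 hq0 hq).comp_injective
    Sum.inr_injective).comp_injective Sum.inr_injective
  have hS' : Summable fun p : ℤ × ℕ ↦ weierstrassPDivCoeff 1 0 (Sum.inr (Sum.inr p)) *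
      Periodic.qParam (1 : ℕ) τ ^ weierstrassPDivExp 1 0 (Sum.inr (Sum.inr p)) :=
    Summable.of_norm (hS.congr fun p ↦ by simp [norm_pow])
  refine hS'.prod.congr fun m ↦ ?_
  exact (hasSum_weierstrassPDivCoeff_B (N := 1) 0 τ m).tsum_eq

/-- **`f_v = K_v + ∑_m [c_m ≠ 0] N² A_m - ∑_{m ≠ 0} B_m`**: the row decomposition with the
constant pieces (`c_m = 0`, `m = 0`) separated; all three `m`-series converge absolutely.
[cite: DiamondShurman2005, §4.6] -/
theorem weierstrassPDiv_eq_const_add_tsum (v : Fin 2 → ℤ) (τ : ℍ) :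
    weierstrassPDiv N v τ = weierstrassPDivConst N v +
      ((∑' m : ℤ, (if v 0 - N * m = 0 then 0 else
          (N : ℂ) ^ 2 * ∑' n : ℤ, eisSummand 2 ![v 0 - N * m, v 1 - N * n] τ)) +
        ∑' m : ℤ, (if m = 0 then 0 else -e2Summand m τ)) := by
  have hN : N ≠ 0 := NeZero.ne N
  set SA : ℂ := ∑' m : ℤ, (if v 0 - N * m = 0 then 0 else
      (N : ℂ) ^ 2 * ∑' n : ℤ, eisSummand 2 ![v 0 - N * m, v 1 - N * n] τ) with hSA
  set SB : ℂ := ∑' m : ℤ, (if m = 0 then 0 else -e2Summand m τ) with hSB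
  have hrows := hasSum_rows_weierstrassPDiv (N := N) v τ
  simp_rw [tsum_weierstrassPDiv_row] at hrows
  -- `N² A_m = [c_m = 0] N² K + [c_m ≠ 0] N² A_m`, `B_m = [m = 0] 2ζ(2) + [m ≠ 0] B_m`
  have hK : ∀ m : ℤ, v 0 - N * m = 0 →
      (N : ℂ) ^ 2 * ∑' n : ℤ, eisSummand 2 ![v 0 - N * m, v 1 - N * n] τ =
        (N : ℂ) ^ 2 * ∑' n : ℤ, (((v 1 - N * n : ℤ) : ℂ) ^ 2)⁻¹ := by
    intro m hm
    congr 1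
    refine tsum_congr fun n ↦ ?_
    simp only [eisSummand, Fin.isValue, Matrix.cons_val_zero, hm, Int.cast_zero, zero_mul,
      zero_add, Matrix.cons_val_one, Matrix.cons_val_fin_one, _root_.zpow_neg, zpow_ofNat]
  have hsplit : ∀ m : ℤ,
      (N : ℂ) ^ 2 * ∑' n : ℤ, eisSummand 2 ![v 0 - N * m, v 1 - N * n] τ - e2Summand m τ =
        ((if v 0 - N * m = 0 then (N : ℂ) ^ 2 * ∑' n : ℤ, (((v 1 - N * n : ℤ) : ℂ) ^ 2)⁻¹
            else 0) - (if m = 0 then 2 * riemannZeta 2 else 0)) +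
        ((if v 0 - N * m = 0 then 0 else
            (N : ℂ) ^ 2 * ∑' n : ℤ, eisSummand 2 ![v 0 - N * m, v 1 - N * n] τ) +
          (if m = 0 then 0 else -e2Summand m τ)) := by
    intro m
    by_cases hc : v 0 - N * m = 0
    · rw [hK m hc]
      by_cases hm : m = 0
      · subst hm
        simp only [hc, if_true, e2Summand_zero_eq_two_riemannZeta_two]
        ring
      · simp only [hc, if_true, hm, if_false]
        ring
    · by_cases hm : m = 0
      · subst hm
        simp only [hc, if_false, if_true, e2Summand_zero_eq_two_riemannZeta_two]
        ring
      · simp only [hc, hm, if_false]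
        ring
  simp_rw [hsplit] at hrows
  -- the finitely supported part
  have hfinA : HasSum (fun m : ℤ ↦ (if v 0 - N * m = 0 then
      (N : ℂ) ^ 2 * ∑' n : ℤ, (((v 1 - N * n : ℤ) : ℂ) ^ 2)⁻¹ else 0))
      (if (N : ℤ) ∣ v 0 then (N : ℂ) ^ 2 * ∑' n : ℤ, (((v 1 - N * n : ℤ) : ℂ) ^ 2)⁻¹ else 0) := by
    by_cases hdvd : (N : ℤ) ∣ v 0
    · obtain ⟨m₀, hm₀⟩ := hdvd
      rw [if_pos ⟨m₀, hm₀⟩]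
      have heq : ∀ m : ℤ, (v 0 - N * m = 0) ↔ m = m₀ := fun m ↦ by
        constructor
        · intro h
          have : (N : ℤ) * m = N * m₀ := by omega
          exact mul_left_cancel₀ (by exact_mod_cast hN) this
        · rintro rfl
          omega
      simp_rw [heq]
      exact hasSum_ite_eq m₀ _
    · rw [if_neg hdvd]
      refine hasSum_zero.congr_fun fun m ↦ ?_
      rw [if_neg]
      intro h
      exact hdvd ⟨m, by omega⟩
  have hfinB : HasSum (fun m : ℤ ↦ (if m = 0 then 2 * riemannZeta 2 else 0))
      (2 * riemannZeta 2) := hasSum_ite_eq 0 _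
  have hrest : HasSum (fun m : ℤ ↦
      (if v 0 - N * m = 0 then 0 else
          (N : ℂ) ^ 2 * ∑' n : ℤ, eisSummand 2 ![v 0 - N * m, v 1 - N * n] τ) +
        (if m = 0 then 0 else -e2Summand m τ)) (SA + SB) :=
    (summable_weierstrassPDiv_A v τ).hasSum.add (summable_ite_neg_e2Summand τ).hasSum
  have := (hfinA.sub hfinB).add hrest
  rw [hrows.unique this, weierstrassPDivConst]

/-- **The monomial expansion of `f_v`**: the absolutely summable family of monomials
`coeff(i) q_N^{exp(i)}` sums to `f_v(τ)`. [cite: DiamondShurman2005, §4.6] -/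
theorem hasSum_weierstrassPDiv_monomials (v : Fin 2 → ℤ) (τ : ℍ) :
    HasSum (fun i ↦ weierstrassPDivCoeff N v i * Periodic.qParam N τ ^ weierstrassPDivExp N v i)
      (weierstrassPDiv N v τ) := by
  have hN : N ≠ 0 := NeZero.ne N
  have hq0 : 0 ≤ ‖Periodic.qParam N τ‖ := norm_nonneg _
  have hq : ‖Periodic.qParam N τ‖ < 1 := Periodic.norm_qParam_lt_one (Nat.cast_pos.mpr (NeZero.pos N)) τ.im_pos
  have hall : Summable fun i ↦ weierstrassPDivCoeff N v i * Periodic.qParam N τ ^ weierstrassPDivExp N v i :=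
    Summable.of_norm ((summable_norm_weierstrassPDivCoeff_mul_pow (N := N) v hq0 hq).congr
      fun i ↦ by simp [norm_pow])
  -- the three partial sums
  set SA : ℂ := ∑' m : ℤ, (if v 0 - N * m = 0 then 0 else
      (N : ℂ) ^ 2 * ∑' n : ℤ, eisSummand 2 ![v 0 - N * m, v 1 - N * n] τ) with hSA
  set SB : ℂ := ∑' m : ℤ, (if m = 0 then 0 else -e2Summand m τ) with hSB
  have hA : HasSum (fun p : ℤ × ℕ ↦ weierstrassPDivCoeff N v (Sum.inr (Sum.inl p)) *
      Periodic.qParam N τ ^ weierstrassPDivExp N v (Sum.inr (Sum.inl p))) SA := by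
    have hs : Summable fun p : ℤ × ℕ ↦ weierstrassPDivCoeff N v (Sum.inr (Sum.inl p)) *
        Periodic.qParam N τ ^ weierstrassPDivExp N v (Sum.inr (Sum.inl p)) :=
      (hall.comp_injective Sum.inr_injective).comp_injective Sum.inl_injective
    have h := hs.hasSum
    rw [hs.tsum_prod] at h
    have heq : ∑' (m : ℤ) (r : ℕ), weierstrassPDivCoeff N v (Sum.inr (Sum.inl (m, r))) *
        Periodic.qParam N τ ^ weierstrassPDivExp N v (Sum.inr (Sum.inl (m, r))) = SA :=
      tsum_congr fun m ↦ (hasSum_weierstrassPDivCoeff_A v τ m).tsum_eq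
    rwa [heq] at h
  have hB : HasSum (fun p : ℤ × ℕ ↦ weierstrassPDivCoeff N v (Sum.inr (Sum.inr p)) *
      Periodic.qParam N τ ^ weierstrassPDivExp N v (Sum.inr (Sum.inr p))) SB := by
    have hs : Summable fun p : ℤ × ℕ ↦ weierstrassPDivCoeff N v (Sum.inr (Sum.inr p)) *
        Periodic.qParam N τ ^ weierstrassPDivExp N v (Sum.inr (Sum.inr p)) :=
      (hall.comp_injective Sum.inr_injective).comp_injective Sum.inr_injective
    have h := hs.hasSum
    rw [hs.tsum_prod] at h
    have heq : ∑' (m : ℤ) (r : ℕ), weierstrassPDivCoeff N v (Sum.inr (Sum.inr (m, r))) *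
        Periodic.qParam N τ ^ weierstrassPDivExp N v (Sum.inr (Sum.inr (m, r))) = SB :=
      tsum_congr fun m ↦ (hasSum_weierstrassPDivCoeff_B (N := N) v τ m).tsum_eq
    rwa [heq] at h
  have hC : HasSum (fun u : Unit ↦ weierstrassPDivCoeff N v (Sum.inl u) *
      Periodic.qParam N τ ^ weierstrassPDivExp N v (Sum.inl u)) (weierstrassPDivConst N v) := by
    have h := hasSum_fintype (fun _ : Unit ↦ weierstrassPDivConst N v)
    simp only [Finset.univ_unique, Finset.sum_singleton] at h
    refine h.congr_fun fun u ↦ ?_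
    simp only [weierstrassPDivCoeff, weierstrassPDivExp, pow_zero, mul_one]
  have htot : HasSum (fun i ↦ weierstrassPDivCoeff N v i * Periodic.qParam N τ ^ weierstrassPDivExp N v i)
      (weierstrassPDivConst N v + (SA + SB)) := HasSum.sum hC (HasSum.sum hA hB)
  rwa [← weierstrassPDiv_eq_const_add_tsum v τ] at htot

/-! ### Limit at `i∞`, boundedness, holomorphy -/

/-- Monomials with exponent `0` have coefficient `0`, except the constant term. [folklore] -/
theorem weierstrassPDivCoeff_eq_zero_of_exp_eq_zero (v : Fin 2 → ℤ)
    (i : Unit ⊕ (ℤ × ℕ) ⊕ (ℤ × ℕ)) (hi : i ≠ Sum.inl ()) (h0 : weierstrassPDivExp N v i = 0) :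
    weierstrassPDivCoeff N v i = 0 := by
  rcases i with u | ⟨m, r⟩ | ⟨m, r⟩
  · exact absurd rfl hi
  · simp only [weierstrassPDivExp, mul_eq_zero, Int.natAbs_eq_zero] at h0
    rcases h0 with rfl | hc
    · simp [weierstrassPDivCoeff]
    · simp [weierstrassPDivCoeff, hc]
  · simp only [weierstrassPDivExp, mul_eq_zero, Int.natAbs_eq_zero, NeZero.ne N, false_or] at h0
    rcases h0 with rfl | hm
    · simp [weierstrassPDivCoeff]
    · simp [weierstrassPDivCoeff, hm]

/-- **`f_v(τ) → K_v` as `Im τ → ∞`** (Tannery's theorem applied to the monomial expansion); in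
particular `f_v(τ) → -2ζ(2) = -π²/3` when `N ∤ c_v`. [cite: DiamondShurman2005, §4.6] -/
theorem tendsto_weierstrassPDiv_atImInfty (v : Fin 2 → ℤ) :
    Tendsto (weierstrassPDiv N v) atImInfty (𝓝 (weierstrassPDivConst N v)) := by
  have hNr : (0 : ℝ) < N := Nat.cast_pos.mpr (NeZero.pos N)
  set x₀ : ℝ := Real.exp (-2 * π * 1 / N) with hx₀
  have hx0 : 0 ≤ x₀ := (Real.exp_pos _).le
  have hx1 : x₀ < 1 := by
    rw [hx₀, Real.exp_lt_one_iff]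
    exact div_neg_of_neg_of_pos (by linarith [Real.pi_pos]) hNr
  have hbound := summable_norm_weierstrassPDivCoeff_mul_pow (N := N) v hx0 hx1
  have hlim : ∀ i, Tendsto (fun τ : ℍ ↦ weierstrassPDivCoeff N v i *
      Periodic.qParam N τ ^ weierstrassPDivExp N v i) atImInfty
      (𝓝 (if weierstrassPDivExp N v i = 0 then weierstrassPDivCoeff N v i else 0)) := by
    intro i
    by_cases h : weierstrassPDivExp N v i = 0
    · simp only [h, pow_zero, mul_one, if_true]
      exact tendsto_const_nhds
    · rw [if_neg h]
      have := ((qParam_tendsto_atImInfty hNr).pow (weierstrassPDivExp N v i)).const_mul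
        (weierstrassPDivCoeff N v i)
      simpa [zero_pow h] using this
  have hev : ∀ᶠ τ : ℍ in atImInfty, ∀ i, ‖weierstrassPDivCoeff N v i *
      Periodic.qParam N τ ^ weierstrassPDivExp N v i‖ ≤
        ‖weierstrassPDivCoeff N v i‖ * x₀ ^ weierstrassPDivExp N v i := by
    rw [Filter.Eventually, atImInfty_mem]
    refine ⟨1, fun τ hτ i ↦ ?_⟩
    rw [norm_mul, norm_pow]
    gcongr
    rw [Periodic.norm_qParam, hx₀, Real.exp_le_exp, UpperHalfPlane.coe_im]
    exact div_le_div_of_nonneg_right (by nlinarith [Real.pi_pos]) hNr.le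
  have h := tendsto_tsum_of_dominated_convergence hbound hlim hev
  have hL : (fun τ : ℍ ↦ ∑' i, weierstrassPDivCoeff N v i *
      Periodic.qParam N τ ^ weierstrassPDivExp N v i) = weierstrassPDiv N v :=
    funext fun τ ↦ (hasSum_weierstrassPDiv_monomials v τ).tsum_eq
  have hR : ∑' i, (if weierstrassPDivExp N v i = 0 then weierstrassPDivCoeff N v i else 0) =
      weierstrassPDivConst N v := by
    rw [tsum_eq_single (Sum.inl ())]
    · simp [weierstrassPDivExp, weierstrassPDivCoeff]
    · intro i hi
      by_cases h0 : weierstrassPDivExp N v i = 0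
      · rw [if_pos h0, weierstrassPDivCoeff_eq_zero_of_exp_eq_zero v i hi h0]
      · rw [if_neg h0]
  rwa [hL, hR] at h

/-- **Every `℘`-division value `f_v` is bounded at `i∞`.** [cite: DiamondShurman2005, §4.6] -/
theorem isBoundedAtImInfty_weierstrassPDiv (v : Fin 2 → ℤ) :
    IsBoundedAtImInfty (weierstrassPDiv N v) :=
  (tendsto_weierstrassPDiv_atImInfty v).isBigO_one ℝ

/-- **Every `℘`-division value `f_v` is holomorphic on `ℍ`** (locally uniform convergence of the
monomial expansion on half-planes `Im τ > y₀ > 0`). [cite: DiamondShurman2005, §4.6] -/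
theorem mdifferentiable_weierstrassPDiv (v : Fin 2 → ℤ) :
    MDifferentiable 𝓘(ℂ) 𝓘(ℂ) (weierstrassPDiv N v) := by
  have hNr : (0 : ℝ) < N := Nat.cast_pos.mpr (NeZero.pos N)
  rw [UpperHalfPlane.mdifferentiable_iff]
  intro z hz
  have hz' : 0 < z.im := hz
  set y₀ : ℝ := z.im / 2 with hy₀
  have hy₀pos : 0 < y₀ := by positivity
  have hU : IsOpen {w : ℂ | y₀ < w.im} := isOpen_lt continuous_const Complex.continuous_im
  have hzU : z ∈ {w : ℂ | y₀ < w.im} := by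
    show y₀ < z.im
    rw [hy₀]
    linarith
  set x₀ : ℝ := Real.exp (-2 * π * y₀ / N) with hx₀
  have hx0 : 0 ≤ x₀ := (Real.exp_pos _).le
  have hx1 : x₀ < 1 := by
    rw [hx₀, Real.exp_lt_one_iff]
    exact div_neg_of_neg_of_pos (by nlinarith [Real.pi_pos]) hNr
  have hbound := summable_norm_weierstrassPDivCoeff_mul_pow (N := N) v hx0 hx1
  have hdiff : DifferentiableOn ℂ (fun w : ℂ ↦ ∑' i, weierstrassPDivCoeff N v i *
      Periodic.qParam N w ^ weierstrassPDivExp N v i) {w : ℂ | y₀ < w.im} := by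
    refine differentiableOn_tsum_of_summable_norm hbound (fun i ↦ ?_) hU (fun i w hw ↦ ?_)
    · exact ((differentiable_const _).mul
        ((Periodic.differentiable_qParam (h := N)).pow _)).differentiableOn
    · rw [norm_mul, norm_pow]
      gcongr
      rw [Periodic.norm_qParam, hx₀, Real.exp_le_exp]
      have hw' : y₀ ≤ w.im := le_of_lt hw
      exact div_le_div_of_nonneg_right (by nlinarith [Real.pi_pos]) hNr.le
  have heq : Set.EqOn (weierstrassPDiv N v ∘ ofComplex) (fun w : ℂ ↦ ∑' i,
      weierstrassPDivCoeff N v i * Periodic.qParam N w ^ weierstrassPDivExp N v i)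
      {w : ℂ | y₀ < w.im} := by
    intro w hw
    have hw0 : 0 < w.im := lt_trans hy₀pos hw
    simp only [Function.comp_apply, ofComplex_apply_of_im_pos hw0]
    exact ((hasSum_weierstrassPDiv_monomials v ⟨w, hw0⟩).tsum_eq).symm
  exact ((hdiff.congr heq).differentiableAt (hU.mem_nhds hzU)).differentiableWithinAt

end Literature.NumberTheory.EllipticCurves.ModularForms
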